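import Literature.MathematicalPhysics.QuantumManyBody.BoseGasHardSet
import Literature.MathematicalPhysics.QuantumManyBody.BoseGasClusterStates

/-!
# Potentials without a hard core have no critical density

Topic `Literature/MathematicalPhysics/QuantumManyBody`, over `BoseGasHardSet.lean` (the hard set
`𝓗(v)` of a pair potential, `ballIntegral`), `BoseGasClusterStates.lean` (cluster trial states:
one boson per tiny cube, `exists_infEnergy_clusterRegion_le`) and
`BoseGasThermodynamicLimitRuelle.lean` (`criticalDensity v = ρ_c(v)`, the subadditivity bound
`limsup_energyPerParticle_le`).

**Dichotomy, first half.** Say that the measurable finite-range potential `v` has a *hard core*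
if some ball `B(0, a)`, `a > 0`, of relative positions lies in its hard set `𝓗(v)` (finite-energy
wave functions vanish whenever two particles are closer than `a`: hard spheres, but also `+∞` or
non-integrable singularities on a dense set of small distances). This file proves that **without a
hard core the critical density is infinite**:

* `criticalDensity_eq_top_of_noHardCore` — if every ball `B(0, a)` contains a relative position
  outside `𝓗(v)`, then `ρ_c(v) = +∞`;
* `tendsto_energyPerParticleDirichlet_of_noHardCore` — hence (Ruelle) the Dirichlet energies per
  particle converge at every density, i.e. the conclusion of `LSSY2005_e0_dirichlet_exists` holds
  for every such `v` (the hard-core case is the subject of the sequel files).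

Proof (a hierarchical cluster; we know no printed source for these carriers and tag it
folklore). Choose relative positions `t₀, t₁, …` outside `𝓗(v)`, with integrability radii
`η_k ≤ |t_k|` and `|t_{k+1}| < η_k / 4` (possible since arbitrarily small good positions exist).
The `2ⁿ` points `∑_k b_k t_k`, `b ∈ {0,1}ⁿ`, have pairwise differences `± t_{k₀} + r` with
`|r| ≤ ∑_{k > k₀} |t_k| ≤ η_{k₀}/3` (`k₀` the first index where the digits differ), so they are
`≥ 2η_{k₀}/3` apart and every ball of radius `2s`, `s = budget_n / 4 ≤ η_{k₀}/16`, around a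
difference lies in the integrability ball `B(±t_{k₀}, η_{k₀})`. By
`exists_infEnergy_clusterRegion_le` the `2ⁿ` bosons placed one per cube of side `s` around these
points (all inside `Λ₄`) have finite energy, so `E₀^D(2ⁿ, 4) < ∞` for every `n`, whence
`e⁺(ρ) < ∞` for every `ρ` by subadditivity and `ρ_c(v) = ∞`.

References: D. Ruelle, *Statistical Mechanics: Rigorous Results* (1969) [Ruelle1969], §3.3.12
("the close-packing density is `+∞` in the absence of hard cores") and §3.5.11; E. H. Lieb,
R. Seiringer, J. P. Solovej, J. Yngvason, *The Mathematics of the Bose Gas and its Condensation*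
(2005) [LSSY2005], Ch. 2 (2.2).
-/

noncomputable section

open MeasureTheory Filter Topology Set Function Metric
open scoped ENNReal NNReal

namespace Literature.MathematicalPhysics.QuantumManyBody.BoseGas

/-! ### Good relative positions at every scale -/

section GoodVec

variable {v : ℝ → ℝ≥0∞}

/-- **No hard core ⇒ small good relative positions with a margin.** If every ball `B(0,a)`
contains a relative position outside the hard set, then for every `a > 0` there is `t` with
`0 < η ≤ |t| < a` and `∫_{B(t,η)} v(|w|) dw < ∞`. [folklore] -/
theorem exists_goodVec (h : ∀ a : ℝ, 0 < a → ∃ z : Space, ‖z‖ < a ∧ z ∉ hardVec v) {a : ℝ}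
    (ha : 0 < a) :
    ∃ p : Space × ℝ, 0 < p.2 ∧ p.2 ≤ ‖p.1‖ ∧ ‖p.1‖ < a ∧ ballIntegral v p.1 p.2 < ⊤ := by
  obtain ⟨z, hz, hzH⟩ := h a ha
  obtain ⟨η, hη, hfin⟩ := not_mem_hardVec_iff.1 hzH
  by_cases hz0 : z = 0
  · subst hz0
    set r : ℝ := min a η / 4 with hr
    have hr0 : 0 < r := by positivity
    have hra : r < a := by
      have := min_le_left a η; rw [hr]; linarith
    have hrη : 2 * r ≤ η := by
      have := min_le_right a η; rw [hr]; linarith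
    refine ⟨(r • unitE, r), hr0, (norm_smul_unitE hr0.le).ge, by rwa [norm_smul_unitE hr0.le], ?_⟩
    change ballIntegral v (r • unitE) r < ⊤
    refine lt_of_le_of_lt (ballIntegral_mono fun w hw => ?_) hfin
    rw [mem_ball, dist_zero_right]
    rw [mem_ball, dist_eq_norm] at hw
    calc ‖w‖ = ‖(w - r • unitE) + r • unitE‖ := by rw [sub_add_cancel]
      _ ≤ ‖w - r • unitE‖ + ‖r • unitE‖ := norm_add_le _ _
      _ < r + r := by rw [norm_smul_unitE hr0.le]; exact add_lt_add_left hw r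
      _ ≤ η := by linarith
  · refine ⟨(z, min η ‖z‖), lt_min hη (norm_pos_iff.2 hz0), min_le_right _ _, hz, ?_⟩
    exact lt_of_le_of_lt (ballIntegral_mono (ball_subset_ball (min_le_left _ _))) hfin

variable (h : ∀ a : ℝ, 0 < a → ∃ z : Space, ‖z‖ < a ∧ z ∉ hardVec v)

/-- A chosen good relative position of size below the budget `a`. [folklore] -/
def goodVec (a : {a : ℝ // 0 < a}) : Space × ℝ :=
  Classical.choose (exists_goodVec h a.2)

/-- The defining properties of `goodVec`. [folklore] -/
theorem goodVec_spec (a : {a : ℝ // 0 < a}) :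
    0 < (goodVec h a).2 ∧ (goodVec h a).2 ≤ ‖(goodVec h a).1‖ ∧ ‖(goodVec h a).1‖ < a ∧
      ballIntegral v (goodVec h a).1 (goodVec h a).2 < ⊤ :=
  Classical.choose_spec (exists_goodVec h a.2)

/-- The budgets of the hierarchy: `a₀ = 1`, `a_{k+1} = η_k / 4`. [folklore] -/
def hierBudget : ℕ → {a : ℝ // 0 < a}
  | 0 => ⟨1, one_pos⟩
  | k + 1 => ⟨(goodVec h (hierBudget k)).2 / 4, div_pos (goodVec_spec h _).1 four_pos⟩

/-- The relative positions `t_k` of the hierarchy. [folklore] -/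
def hierVec (k : ℕ) : Space := (goodVec h (hierBudget h k)).1

/-- The integrability radii `η_k` of the hierarchy. [folklore] -/
def hierRad (k : ℕ) : ℝ := (goodVec h (hierBudget h k)).2

/-- `η_k > 0`. [folklore] -/
theorem hierRad_pos (k : ℕ) : 0 < hierRad h k := (goodVec_spec h _).1

/-- `η_k ≤ |t_k|`. [folklore] -/
theorem hierRad_le_norm (k : ℕ) : hierRad h k ≤ ‖hierVec h k‖ := (goodVec_spec h _).2.1

/-- `|t_k| < a_k`. [folklore] -/
theorem norm_hierVec_lt (k : ℕ) : ‖hierVec h k‖ < hierBudget h k := (goodVec_spec h _).2.2.1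

/-- `∫_{B(t_k, η_k)} v(|w|) dw < ∞`. [folklore] -/
theorem ballIntegral_hierVec_lt_top (k : ℕ) :
    ballIntegral v (hierVec h k) (hierRad h k) < ⊤ := (goodVec_spec h _).2.2.2

/-- `a₀ = 1`. [folklore] -/
theorem hierBudget_zero : (hierBudget h 0 : ℝ) = 1 := rfl

/-- `a_{k+1} = η_k / 4`. [folklore] -/
theorem hierBudget_succ (k : ℕ) : (hierBudget h (k + 1) : ℝ) = hierRad h k / 4 := rfl

/-- All budgets are at most `1`. [folklore] -/
theorem hierBudget_le_one : ∀ k : ℕ, (hierBudget h k : ℝ) ≤ 1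
  | 0 => le_rfl
  | k + 1 => by
    rw [hierBudget_succ]
    have h1 := hierRad_le_norm h k
    have h2 := norm_hierVec_lt h k
    have h3 := hierBudget_le_one k
    have h4 := hierRad_pos h k
    linarith

/-- The budgets decay geometrically below every radius: `a_j ≤ η_k / 4^{j-k}` for `k < j`.
[folklore] -/
theorem hierBudget_le (k : ℕ) : ∀ i : ℕ, (hierBudget h (k + 1 + i) : ℝ) ≤ hierRad h k / 4 ^ (i + 1)
  | 0 => by rw [add_zero, hierBudget_succ, zero_add, pow_one]
  | i + 1 => by
    have ih := hierBudget_le k i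
    rw [show k + 1 + (i + 1) = (k + 1 + i) + 1 by ring, hierBudget_succ]
    have h1 := hierRad_le_norm h (k + 1 + i)
    have h2 := norm_hierVec_lt h (k + 1 + i)
    rw [pow_succ, ← div_div]
    linarith [div_le_div_of_nonneg_right (h1.trans h2.le |>.trans ih) (by norm_num : (0:ℝ) ≤ 4)]

/-- `|t_{k+1+i}| < η_k / 4^{i+1}`. [folklore] -/
theorem norm_hierVec_lt' (k i : ℕ) : ‖hierVec h (k + 1 + i)‖ < hierRad h k / 4 ^ (i + 1) :=
  (norm_hierVec_lt h _).trans_le (hierBudget_le h k i)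

/-- The tail sums of the hierarchy: `R(k, M) = ∑_{i<M} |t_{k+1+i}|`. [folklore] -/
def hierTail (k M : ℕ) : ℝ := ∑ i ∈ Finset.range M, ‖hierVec h (k + 1 + i)‖

/-- Tails are nonnegative. [folklore] -/
theorem hierTail_nonneg (k M : ℕ) : 0 ≤ hierTail h k M :=
  Finset.sum_nonneg fun _ _ => norm_nonneg _

/-- One more term in the tail. [folklore] -/
theorem hierTail_succ (k M : ℕ) : hierTail h k (M + 1) = hierTail h k M + ‖hierVec h (k + 1 + M)‖ :=
  Finset.sum_range_succ _ _

/-- **The tails are small**: `∑_{j>k} |t_j| ≤ η_k / 3`. [folklore] -/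
theorem hierTail_le (k : ℕ) : ∀ M : ℕ, hierTail h k M + hierRad h k / 3 / 4 ^ M ≤ hierRad h k / 3
  | 0 => by simp [hierTail]
  | M + 1 => by
    have ih := hierTail_le k M
    have hlt := norm_hierVec_lt' h k M
    rw [hierTail_succ]
    have : hierRad h k / 4 ^ (M + 1) + hierRad h k / 3 / 4 ^ (M + 1) = hierRad h k / 3 / 4 ^ M := by
      rw [pow_succ]; ring
    linarith

/-- `∑_{k<j<n} |t_j| ≤ η_k / 3`. [folklore] -/
theorem hierTail_le' (k M : ℕ) : hierTail h k M ≤ hierRad h k / 3 := by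
  have := hierTail_le h k M
  have h0 : 0 ≤ hierRad h k / 3 / 4 ^ M := by
    have := hierRad_pos h k; positivity
  linarith

end GoodVec

/-! ### The hierarchical point set -/

section Points

variable {v : ℝ → ℝ≥0∞} (h : ∀ a : ℝ, 0 < a → ∃ z : Space, ‖z‖ < a ∧ z ∉ hardVec v)

/-- The `2ⁿ` points `∑_k b_k t_k` of the hierarchy, indexed by `m < 2ⁿ` through its binary
digits (the last vector `t_{n-1}` corresponds to the lowest digit). [folklore] -/
def hierPts : ℕ → ℕ → Space
  | 0, _ => 0
  | n + 1, m => hierPts n (m / 2) + if m % 2 = 1 then hierVec h n else 0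

/-- The points lie within `|t₀| + ∑_{k>0} |t_k|` of the origin. [folklore] -/
theorem norm_hierPts_le : ∀ (n m : ℕ), ‖hierPts h n m‖ ≤ ∑ k ∈ Finset.range n, ‖hierVec h k‖
  | 0, m => by simp [hierPts]
  | n + 1, m => by
    rw [hierPts, Finset.sum_range_succ]
    refine (norm_add_le _ _).trans (add_le_add (norm_hierPts_le n _) ?_)
    split_ifs
    · exact le_rfl
    · rw [norm_zero]; exact norm_nonneg _

/-- `|p| < 4/3` for every point of the hierarchy. [folklore] -/
theorem norm_hierPts_lt (n m : ℕ) : ‖hierPts h n m‖ < 4 / 3 := by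
  refine (norm_hierPts_le h n m).trans_lt ?_
  have h0 : ‖hierVec h 0‖ < 1 := by
    have := norm_hierVec_lt h 0; rwa [hierBudget_zero] at this
  have hη0 : hierRad h 0 ≤ 1 := (hierRad_le_norm h 0).trans h0.le
  rcases n with _ | n
  · simp
  · rw [Finset.sum_range_succ']
    have ht : ∑ k ∈ Finset.range n, ‖hierVec h (k + 1)‖ = hierTail h 0 n := by
      unfold hierTail
      exact Finset.sum_congr rfl fun i _ => by rw [zero_add, add_comm]
    rw [ht]
    have := hierTail_le' h 0 n
    linarith

/-- **Differences of hierarchy points**: two distinct points differ by `± t_{k₀}` up to the tail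
`∑_{k₀ < k < n} |t_k|`, where `k₀ < n` is the first index at which their digits differ.
[folklore] -/
theorem hierPts_sub : ∀ (n m m' : ℕ), m < 2 ^ n → m' < 2 ^ n → m ≠ m' →
    ∃ k₀ : ℕ, k₀ < n ∧ ∃ ε : ℝ, (ε = 1 ∨ ε = -1) ∧
      ‖(hierPts h n m - hierPts h n m') - ε • hierVec h k₀‖ ≤ hierTail h k₀ (n - (k₀ + 1))
  | 0, m, m', hm, hm', hne => by
    simp only [pow_zero, Nat.lt_one_iff] at hm hm'
    exact absurd (hm.trans hm'.symm) hne
  | n + 1, m, m', hm, hm', hne => by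
    have hq : m / 2 < 2 ^ n := by
      rw [Nat.div_lt_iff_lt_mul two_pos]; rwa [pow_succ] at hm
    have hq' : m' / 2 < 2 ^ n := by
      rw [Nat.div_lt_iff_lt_mul two_pos]; rwa [pow_succ] at hm'
    by_cases hqq : m / 2 = m' / 2
    · -- same higher digits: the lowest digits differ, the difference is `± t_n`
      have hb : m % 2 ≠ m' % 2 := by
        intro hb
        apply hne
        rw [← Nat.div_add_mod m 2, ← Nat.div_add_mod m' 2, hqq, hb]
      refine ⟨n, Nat.lt_succ_self n, ?_⟩
      have hcases : (m % 2 = 1 ∧ m' % 2 = 0) ∨ (m % 2 = 0 ∧ m' % 2 = 1) := by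
        have h1 := Nat.mod_two_eq_zero_or_one m
        have h2 := Nat.mod_two_eq_zero_or_one m'
        omega
      rcases hcases with ⟨h1, h2⟩ | ⟨h1, h2⟩
      · refine ⟨1, Or.inl rfl, le_of_eq ?_⟩
        rw [show n + 1 - (n + 1) = 0 from Nat.sub_self _]
        simp [hierPts, hqq, h1, h2, hierTail]
      · refine ⟨-1, Or.inr rfl, le_of_eq ?_⟩
        rw [show n + 1 - (n + 1) = 0 from Nat.sub_self _]
        simp [hierPts, hqq, h1, h2, hierTail]
    · obtain ⟨k₀, hk₀, ε, hε, hbound⟩ := hierPts_sub n (m / 2) (m' / 2) hq hq' hqq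
      refine ⟨k₀, hk₀.trans (Nat.lt_succ_self n), ε, hε, ?_⟩
      have hidx : n + 1 - (k₀ + 1) = (n - (k₀ + 1)) + 1 := by omega
      rw [hidx, hierTail_succ, show k₀ + 1 + (n - (k₀ + 1)) = n by omega]
      have hlast : ‖(if m % 2 = 1 then hierVec h n else 0) - (if m' % 2 = 1 then hierVec h n else 0)‖
          ≤ ‖hierVec h n‖ := by
        split_ifs <;> simp
      calc ‖(hierPts h (n + 1) m - hierPts h (n + 1) m') - ε • hierVec h k₀‖
          = ‖((hierPts h n (m / 2) - hierPts h n (m' / 2)) - ε • hierVec h k₀) +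
              ((if m % 2 = 1 then hierVec h n else 0) -
                (if m' % 2 = 1 then hierVec h n else 0))‖ := by
            simp only [hierPts]; congr 1; abel
        _ ≤ _ := (norm_add_le _ _).trans (add_le_add hbound hlast)

/-- **Separation**: two distinct points are at distance at least `(2/3) η_{k₀} ≥ (8/3) a_n`
(`k₀ < n` the first differing digit, `a_n` the last budget). [folklore] -/
theorem le_dist_hierPts {n m m' : ℕ} (hm : m < 2 ^ n) (hm' : m' < 2 ^ n) (hne : m ≠ m') :
    8 / 3 * (hierBudget h n : ℝ) ≤ dist (hierPts h n m) (hierPts h n m') := by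
  obtain ⟨k₀, hk₀, ε, hε, hbound⟩ := hierPts_sub h n m m' hm hm' hne
  have htail := hierTail_le' h k₀ (n - (k₀ + 1))
  have hεnorm : ‖ε • hierVec h k₀‖ = ‖hierVec h k₀‖ := by
    rcases hε with rfl | rfl <;> simp
  have hbud : (hierBudget h n : ℝ) ≤ hierRad h k₀ / 4 := by
    obtain ⟨i, rfl⟩ : ∃ i, n = k₀ + 1 + i := ⟨n - (k₀ + 1), by omega⟩
    refine (hierBudget_le h k₀ i).trans ?_
    refine div_le_div_of_nonneg_left (hierRad_pos h k₀).le four_pos ?_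
    calc (4 : ℝ) = 4 ^ 1 := (pow_one _).symm
      _ ≤ 4 ^ (i + 1) := pow_le_pow_right₀ (by norm_num) (by omega)
  have hrn := hierRad_le_norm h k₀
  rw [dist_eq_norm]
  have key : ‖hierVec h k₀‖ - hierTail h k₀ (n - (k₀ + 1)) ≤ ‖hierPts h n m - hierPts h n m'‖ := by
    have := norm_sub_norm_le (ε • hierVec h k₀) (ε • hierVec h k₀ - (hierPts h n m - hierPts h n m'))
    rw [sub_sub_cancel, hεnorm, norm_sub_rev] at this
    linarith
  linarith

/-- **Integrability around the differences**: the ball of radius `η_{k₀}/2` around the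
difference of two distinct points has finite potential integral, and `2 a_n ≤ η_{k₀}/2`.
[folklore] -/
theorem ballIntegral_hierPts_sub_lt_top {n m m' : ℕ} (hm : m < 2 ^ n) (hm' : m' < 2 ^ n)
    (hne : m ≠ m') :
    ballIntegral v (hierPts h n m - hierPts h n m') (2 * hierBudget h n) < ⊤ := by
  obtain ⟨k₀, hk₀, ε, hε, hbound⟩ := hierPts_sub h n m m' hm hm' hne
  have htail := hierTail_le' h k₀ (n - (k₀ + 1))
  have hbud : (hierBudget h n : ℝ) ≤ hierRad h k₀ / 4 := by
    obtain ⟨i, rfl⟩ : ∃ i, n = k₀ + 1 + i := ⟨n - (k₀ + 1), by omega⟩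
    refine (hierBudget_le h k₀ i).trans ?_
    refine div_le_div_of_nonneg_left (hierRad_pos h k₀).le four_pos ?_
    calc (4 : ℝ) = 4 ^ 1 := (pow_one _).symm
      _ ≤ 4 ^ (i + 1) := pow_le_pow_right₀ (by norm_num) (by omega)
  have hfin : ballIntegral v (ε • hierVec h k₀) (hierRad h k₀) < ⊤ := by
    rcases hε with rfl | rfl
    · rw [one_smul]; exact ballIntegral_hierVec_lt_top h k₀
    · rw [neg_one_smul, ballIntegral_eq_of_norm_eq (norm_neg _)]
      exact ballIntegral_hierVec_lt_top h k₀
  have hη := hierRad_pos h k₀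
  refine lt_of_le_of_lt (ballIntegral_mono (ball_subset_ball' ?_)) hfin
  rw [dist_eq_norm]
  linarith

end Points

/-! ### Finite box energies at every particle number and `ρ_c = ∞` -/

section NoHardCore

variable {v : ℝ → ℝ≥0∞}

/-- A coordinate is at most the norm. [folklore] -/
theorem abs_apply_le_norm_space (x : Space) (k : Fin 3) : |x k| ≤ ‖x‖ := by
  have h := PiLp.dist_apply_le (p := 2) x 0 k
  simpa [Real.dist_eq] using h

/-- **No hard core ⇒ `E₀^D(2ⁿ, 4) < ∞` for every `n`** (the hierarchical cluster state).
[folklore] -/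
theorem groundStateEnergy_two_pow_lt_top_of_noHardCore (hv : Measurable v)
    (h : ∀ a : ℝ, 0 < a → ∃ z : Space, ‖z‖ < a ∧ z ∉ hardVec v) (n : ℕ) :
    groundStateEnergy v (2 ^ n) 4 < ⊤ := by
  -- the scale of the cubes
  set a : ℝ := (hierBudget h n : ℝ) with ha
  have ha0 : 0 < a := (hierBudget h n).2
  have ha1 : a ≤ 1 := hierBudget_le_one h n
  set s : ℝ := a / 4 with hs
  have hs0 : 0 < s := by positivity
  -- the centres, shifted into the box `Λ₄`
  set w₀ : Space := WithLp.toLp 2 fun _ => (2 : ℝ) with hw₀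
  set c : ℕ → Space := fun m => hierPts h n m + w₀ with hc
  have hsep : ∀ m m', m < m' → m' < 2 ^ n → 2 * s ≤ dist (c m) (c m') := by
    intro m m' hmm' hm'
    have hd : dist (c m) (c m') = dist (hierPts h n m) (hierPts h n m') := by
      simp [hc]
    rw [hd]
    have := le_dist_hierPts h (hmm'.trans hm') hm' hmm'.ne
    rw [hs]; linarith
  obtain ⟨E₁, C, hE₁, hC, hbound⟩ := exists_infEnergy_clusterRegion_le hv hs0
  have hle := hbound (2 ^ n) c hsep
  -- the cubes lie in `Λ₄`
  have hregion : clusterRegion c s (2 ^ n) ⊆ box 4 := by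
    intro x hx
    simp only [clusterRegion, Set.mem_iUnion, Finset.mem_range, exists_prop] at hx
    obtain ⟨m, -, hxm⟩ := hx
    refine cubeAt_subset_box (fun k => ?_) hxm
    have hk : |hierPts h n m k| ≤ 4 / 3 :=
      (abs_apply_le_norm_space _ k).trans (norm_hierPts_lt h n m).le
    have hck : c m k = hierPts h n m k + 2 := by simp [hc, hw₀]
    rw [hck]
    rw [abs_le] at hk
    constructor <;> linarith
  -- finiteness of the pair terms
  have hpair : ∀ m ∈ Finset.range (2 ^ n), ∀ m' ∈ Finset.range m, pairBall v c s m' m < ⊤ := by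
    intro m hm m' hm'
    rw [Finset.mem_range] at hm hm'
    unfold pairBall
    have hsub : c m - c m' = hierPts h n m - hierPts h n m' := by simp [hc]
    rw [hsub, show 2 * s = a / 2 by rw [hs]; ring]
    have hrad : a / 2 ≤ 2 * (hierBudget h n : ℝ) := by rw [ha]; linarith
    exact lt_of_le_of_lt (lintegral_mono_set (ball_subset_ball hrad))
      (ballIntegral_hierPts_sub_lt_top h hm (hm'.trans hm) hm'.ne')
  calc groundStateEnergy v (2 ^ n) 4 = infEnergy v (2 ^ n) (box 4) := groundStateEnergy_eq_infEnergy _ _ _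
    _ ≤ infEnergy v (2 ^ n) (clusterRegion c s (2 ^ n)) := infEnergy_anti hregion
    _ ≤ (2 ^ n : ℕ) * E₁ + C * ∑ m ∈ Finset.range (2 ^ n), ∑ m' ∈ Finset.range m,
          pairBall v c s m' m := hle
    _ < ⊤ := by
        refine ENNReal.add_lt_top.2 ⟨ENNReal.mul_lt_top (ENNReal.natCast_lt_top _) hE₁,
          ENNReal.mul_lt_top hC ?_⟩
        exact ENNReal.sum_lt_top.2 fun m hm => ENNReal.sum_lt_top.2 fun m' hm' => hpair m hm m' hm'

/-- **Potentials without a hard core have infinite critical density.** If every ball `B(0, a)`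
of relative positions contains a point outside the hard set `𝓗(v)`, then `e⁺(ρ) < ∞` for
every `ρ > 0` and `ρ_c(v) = +∞`. [cite: Ruelle1969, §3.3.12] -/
theorem limsupEnergyPerParticle_lt_top_of_noHardCore (hv : IsRepulsiveFiniteRange v)
    (h : ∀ a : ℝ, 0 < a → ∃ z : Space, ‖z‖ < a ∧ z ∉ hardVec v) {ρ : ℝ} (hρ : 0 < ρ) :
    limsupEnergyPerParticle v ρ < ⊤ := by
  obtain ⟨R, hR, hv0⟩ := hv.exists_pos_range
  -- enough particles per cell of side `4`
  obtain ⟨n, hn⟩ : ∃ n : ℕ, ρ * (4 + R) ^ 3 < 2 ^ n := by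
    obtain ⟨n, hn⟩ := exists_nat_gt (ρ * (4 + R) ^ 3)
    refine ⟨n, hn.trans ?_⟩
    exact_mod_cast Nat.lt_two_pow_self
  have hfit : 2 * ρ * (4 + R) ^ 3 < (2 ^ n + 2 ^ n : ℕ) := by
    push_cast; linarith
  refine (limsup_energyPerParticle_le hv.1 hv0 hR hρ (by norm_num : (0:ℝ) < 4) hfit).trans_lt ?_
  have hB := groundStateEnergy_two_pow_lt_top_of_noHardCore hv.1 h n
  exact ENNReal.div_lt_top (ENNReal.add_ne_top.2 ⟨hB.ne, hB.ne⟩) (by positivity)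

/-- `ρ_c(v) = +∞` for a potential without a hard core. [cite: Ruelle1969, §3.3.12] -/
theorem criticalDensity_eq_top_of_noHardCore (hv : IsRepulsiveFiniteRange v)
    (h : ∀ a : ℝ, 0 < a → ∃ z : Space, ‖z‖ < a ∧ z ∉ hardVec v) : criticalDensity v = ⊤ := by
  refine ENNReal.eq_top_of_forall_nnreal_le fun r => ?_
  have hρ : (0 : ℝ) < r + 1 := by positivity
  calc (r : ℝ≥0∞) ≤ ENNReal.ofReal ((r : ℝ) + 1) := by
        rw [← ENNReal.ofReal_coe_nnreal]
        exact ENNReal.ofReal_le_ofReal (by linarith)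
    _ ≤ criticalDensity v :=
        le_iSup₂ (f := fun ρ (_ : 0 < ρ ∧ limsupEnergyPerParticle v ρ < ⊤) => ENNReal.ofReal ρ)
          ((r : ℝ) + 1) ⟨hρ, limsupEnergyPerParticle_lt_top_of_noHardCore hv h hρ⟩

/-- **The conclusion of `LSSY2005_e0_dirichlet_exists` for potentials without a hard core**: the
Dirichlet energies per particle converge at every density `ρ > 0` (to the finite `e⁺(ρ)`).
[cite: LSSY2005, Ch. 2 eq. (2.2); Ruelle1969 §3.5.11 (a)] -/
theorem tendsto_energyPerParticleDirichlet_of_noHardCore (hv : IsRepulsiveFiniteRange v)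
    (h : ∀ a : ℝ, 0 < a → ∃ z : Space, ‖z‖ < a ∧ z ∉ hardVec v) {ρ : ℝ} (hρ : 0 < ρ) :
    Tendsto (energyPerParticleDirichlet v ρ) atTop (𝓝 (limsupEnergyPerParticle v ρ)) :=
  tendsto_energyPerParticleDirichlet_of_criticalDensity_eq_top hv
    (criticalDensity_eq_top_of_noHardCore hv h) hρ

/-- Contrapositive: **a finite critical density forces a hard core** — some ball `B(0, a)`,
`a > 0`, of relative positions lies in the hard set. [cite: Ruelle1969, §3.3.12] -/
theorem exists_ball_subset_hardVec_of_criticalDensity_lt_top (hv : IsRepulsiveFiniteRange v)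
    (hc : criticalDensity v < ⊤) : ∃ a : ℝ, 0 < a ∧ ball (0 : Space) a ⊆ hardVec v := by
  by_contra hno
  push Not at hno
  refine absurd (criticalDensity_eq_top_of_noHardCore hv fun a ha => ?_) hc.ne
  obtain ⟨z, hz, hzH⟩ := Set.not_subset.1 (hno a ha)
  exact ⟨z, by rwa [mem_ball, dist_zero_right] at hz, hzH⟩

end NoHardCore

end Literature.MathematicalPhysics.QuantumManyBody.BoseGas

end
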